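import Mathlib
import Summits.ValiantsHypothesis.ValiantsHypothesis.Theorems.RigidityForcesSymmetryRankRigidMinimalReprLaplaceFiveSeparatedCaptureTwoTerm
import Summits.ValiantsHypothesis.ValiantsHypothesis.Theorems.RigidityForcesSymmetryRankRigidMinimalReprLaplaceFiveSeparatedCaptureTwoK2Hub
import Summits.ValiantsHypothesis.ValiantsHypothesis.Theorems.RigidityForcesSymmetryRankRigidMinimalReprLaplaceFiveSeparatedCaptureReadOff

/-!
# ValiantsHypothesis / RigidityForcesSymmetry — crux `LaplaceOptimalFive` (stmt-ValiantsHypothesis-24813), symmetric capture: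
# ★★ **THE EQUAL-SPANS CASE OF `CaptureIneqSym` IS A THEOREM** (`U₀₁ = U₀₂ = U₁₂ = U` arbitrary symmetric ⇒ `dim W ≤ 3·dim U`)

Memo `pub/val-lit/lmr/NOTE-p4g17-24813-K32-symmetric-capture.md` §8 CLAIM E («needed by any proof of (SC), since
cap(U,U,U) = dim(SF ∩ U·V)»), with diagonal entries ALLOWED and `U` of ANY dimension.  The slice of the symmetric capture inequality
containing ALL the tight configurations of record: the Laplace atoms `⟨x₀x₁⟩³` (cap 3 = 3·1) and `⟨x₀x₁, x₂x₃⟩³` (cap 6 = 3·2); it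
contains the equal-LINES case ✓ `finrank_le_three_of_equalLines` (`dim U = 1`).

* `equalSpans_symmetrise` — for equal symmetric spans, a captured tensor symmetric under `(0 1)` and `(1 2)` satisfies
  `3·T = Sp Q`, `(Sp Q)(p,q,r) = Q_r(p,q) + Q_q(p,r) + Q_p(q,r)`, `Q_a = A_a + B_a + C_a ∈ U` (sum of the three cyclic rotations of ✓ `L3_finite_form`);
* `finrank_le_ten_of_symm_zeroDiag` — a space of symmetric zero-diagonal leaf matrices has dimension `≤ 10` (✓ `eq_zero_of_nu`);
* ★★ `finrank_le_three_mul_of_equalSpans` — `finrank W ≤ 3 · finrank U`.  Proof: each obligation `T_μ` (✓ `contractZ_swap12/23`,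
  ✓ `contractZ_rep12`) is `⅓·Sp Q` with `Q ∈ 𝒵(U)` (the repeated-letter vanishing is exactly `Q_c(a,a) + 2Q_a(a,c) = 0`), so
  `μ ↦ 3·T_μ` injects `W` (✓ `hub_injective`) into `Sp(𝒵(U))`, of dimension `≤ finrank 𝒵(U) ≤ 3·finrank U` by LEMMA Z
  (✓ `finrank_Zsp_le`) when `finrank U ≤ 4`; and `finrank W ≤ 10 < 3·finrank U` otherwise.

Honest framing.  ONE sub-case (equal spans) of an OPEN inequality (`CaptureIneqSym`); the general three-span inequality, K1 on
`K₃ ⊔ K₂`, S2′, `LaplaceOptimalFive` (OPEN · CONTESTED 72/120), `RankRigidMinimalRepr`, `VP ≠ VNP` are NOT proved.  One local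
`def` (the linear map `Sp`), no structure / instance / notation / axiom; Mathlib + tree only.
-/

set_option linter.dupNamespace false
set_option autoImplicit false

namespace Summit.ValiantsHypothesis.ValiantsHypothesis.Theorems.RigidityForcesSymmetryRankRigidMinimalRepr

namespace LaplaceFiveSeparatedCapture

open Finset LaplaceFiveSectorSplit

noncomputable section

/-! ### Symmetrisation for EQUAL spans -/

/-- For EQUAL symmetric spans `U₀₁ = U₀₂ = U₁₂ = U`, a captured tensor that is symmetric under the slot transpositions
`(0 1)` and `(1 2)` is one third of the symmetrised placement `(p,q,r) ↦ Q_r(p,q) + Q_q(p,r) + Q_p(q,r)` of a tuple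
`Q : Fin 5 → U` (sum of the three cyclic rotations). [folklore] -/
theorem equalSpans_symmetrise (U : Submodule ℂ (Fin 5 → Fin 5 → ℂ)) (hU : ∀ u ∈ U, ∀ p q, u p q = u q p)
    {T : Fin 5 → Fin 5 → Fin 5 → ℂ} (hT : T ∈ L3 U U U)
    (h12 : ∀ p q r, T p q r = T q p r) (h23 : ∀ p q r, T p q r = T p r q) :
    ∃ Q : Fin 5 → Fin 5 → Fin 5 → ℂ, (∀ b, Q b ∈ U) ∧ ∀ p q r, 3 * T p q r = Q r p q + Q q p r + Q p q r := by
  obtain ⟨A, B, C, hA, hB, hC, hT⟩ := L3_finite_form U U U hT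
  refine ⟨fun b => A b + B b + C b, fun b => U.add_mem (U.add_mem (hA b) (hB b)) (hC b), fun p q r => ?_⟩
  have h1 : T q r p = T p q r := by rw [h23 q r p, ← h12 p q r]
  have h2 : T r p q = T p q r := by rw [h12 r p q, ← h23 p q r]
  have e0 := hT p q r
  have e1 := hT q r p
  have e2 := hT r p q
  have sB1 : B r q p = B r p q := hU _ (hB r) q p
  have sC1 : C q r p = C q p r := hU _ (hC q) r p
  have sA2 : A q r p = A q p r := hU _ (hA q) r p
  have sB2 : B p r q = B p q r := hU _ (hB p) r q
  simp only [Pi.add_apply]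
  linear_combination e0 + e1 + e2 - h1 - h2 + sB1 + sC1 + sA2 + sB2

/-- The symmetrised placement as a linear map: `(Sp Q)(p,q,r) = Q_r(p,q) + Q_q(p,r) + Q_p(q,r)`. -/
def Sp : (Fin 5 → Fin 5 → Fin 5 → ℂ) →ₗ[ℂ] (Fin 5 → Fin 5 → Fin 5 → ℂ) where
  toFun Q := fun p q r => Q r p q + Q q p r + Q p q r
  map_add' Q Q' := by funext p q r; simp only [Pi.add_apply]; ring
  map_smul' c Q := by funext p q r; simp only [Pi.smul_apply, smul_eq_mul, RingHom.id_apply]; ring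

/-- `Sp` entrywise. [folklore] -/
lemma Sp_apply (Q : Fin 5 → Fin 5 → Fin 5 → ℂ) (p q r : Fin 5) : Sp Q p q r = Q r p q + Q q p r + Q p q r := rfl

/-- A space of symmetric zero-diagonal `5 × 5` matrices has dimension at most `10`. [folklore] -/
theorem finrank_le_ten_of_symm_zeroDiag (W : Submodule ℂ (Fin 5 → Fin 5 → ℂ))
    (hWs : ∀ μ ∈ W, ∀ s t : Fin 5, μ s t = μ t s) (hWd : ∀ μ ∈ W, ∀ s : Fin 5, μ s s = 0) :
    Module.finrank ℂ W ≤ 10 := by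
  have hinj : Function.Injective (nuL.domRestrict W) := by
    rw [injective_iff_map_eq_zero]
    intro μ hμ
    apply Subtype.ext
    refine eq_zero_of_nu μ.1 (hWs μ.1 μ.2) (hWd μ.1 μ.2) fun π => ?_
    have := congrFun hμ π
    simpa [nuL_apply] using this
  have h := LinearMap.finrank_le_finrank_of_injective hinj
  rw [Module.finrank_fintype_fun_eq_card, card_P] at h
  exact h

/-- ★★ **THE EQUAL-SPANS CASE OF THE SYMMETRIC CAPTURE INEQUALITY (memo §8 CLAIM E).**  Let `U` be ANY space of symmetric
letter matrices (diagonal entries allowed, any dimension) and `W` a space of symmetric zero-diagonal leaf matrices all of whose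
obligations `T_μ = contractZ μ` are captured by the three EQUAL triangle spans `U₀₁ = U₀₂ = U₁₂ = U`.  Then
`finrank W ≤ 3 · finrank U` — `CaptureIneqSym` restricted to equal spans is a theorem.  Contains both Laplace-atom families
(`⟨x₀x₁⟩³`: 3 = 3·1, `⟨x₀x₁, x₂x₃⟩³`: 6 = 3·2, equality) and the equal-LINES case ✓ `finrank_le_three_of_equalLines`. [folklore] -/
theorem finrank_le_three_mul_of_equalSpans (U W : Submodule ℂ (Fin 5 → Fin 5 → ℂ))
    (hU : ∀ u ∈ U, ∀ p q : Fin 5, u p q = u q p)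
    (hWs : ∀ μ ∈ W, ∀ s t : Fin 5, μ s t = μ t s) (hWd : ∀ μ ∈ W, ∀ s : Fin 5, μ s s = 0)
    (hWc : ∀ μ ∈ W, contractZ μ ∈ L3 U U U) :
    Module.finrank ℂ W ≤ 3 * Module.finrank ℂ U := by
  classical
  by_cases h4 : Module.finrank ℂ U ≤ 4
  · -- every obligation is one third of a symmetrised placement of a tuple in `𝒵(U)`
    have hmem : ∀ μ ∈ W, (3 : ℂ) • contractZ μ ∈ (Zsp U).map Sp := by
      intro μ hμ
      obtain ⟨Q, hQU, hQ⟩ := equalSpans_symmetrise U hU (hWc μ hμ)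
        (fun p q r => (contractZ_swap12 μ p q r).symm) (fun p q r => (contractZ_swap23 μ p q r).symm)
      refine Submodule.mem_map.mpr ⟨Q, mem_Zsp.mpr ⟨hQU, fun a c => ?_⟩, ?_⟩
      · have h := hQ a a c
        rw [contractZ_rep12 μ a c, mul_zero] at h
        linear_combination -h
      · funext p q r
        show Q r p q + Q q p r + Q p q r = 3 * contractZ μ p q r
        rw [hQ p q r]
    let f : W →ₗ[ℂ] ((Zsp U).map Sp) :=
      LinearMap.codRestrict ((Zsp U).map Sp) (((3 : ℂ) • cZ).domRestrict W) (fun μ => by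
        simpa [cZ_apply] using hmem μ.1 μ.2)
    have hf : Function.Injective f := by
      rw [injective_iff_map_eq_zero]
      intro μ hμ
      have h0 : (3 : ℂ) • contractZ μ.1 = 0 := by
        have := congrArg Subtype.val hμ
        simpa [f, cZ_apply] using this
      have hT : contractZ μ.1 = 0 := by
        have := congrArg (fun T => (3 : ℂ)⁻¹ • T) h0
        simpa [smul_smul] using this
      apply Subtype.ext
      refine hub_injective μ.1 (hWs μ.1 μ.2) (hWd μ.1 μ.2) fun p q => ?_
      simp [hT]
    have h1 := LinearMap.finrank_le_finrank_of_injective hf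
    have h2 := Submodule.finrank_map_le Sp (Zsp U)
    have h3 := finrank_Zsp_le U hU h4
    omega
  · have h10 := finrank_le_ten_of_symm_zeroDiag W hWs hWd
    omega

end

end LaplaceFiveSeparatedCapture

end Summit.ValiantsHypothesis.ValiantsHypothesis.Theorems.RigidityForcesSymmetryRankRigidMinimalRepr
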